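import Summits.QuantumFields.YangMills.Theorems.BalabanUVNodesK0RecordFormatNamesLemmas2
import Literature.MathematicalPhysics.QuantumFieldTheory.Balaban1983to89.B12Decay510Torus

/-!
# K0ᴬ JOIN-T, GEOMETRY HAND β — CORE: the torus-geometry lemmas behind the LARGE-OR-FAR rows (G1)(G2) of `kstep_joinT_at_record`

Cell `ym-nodeO-ideate`, helper-hand seat `ymgap-nodeO-hand-geomB` (gen 0; ladder-directors R657-ym, director-ym №533 (3) ∕ №535, ◆ CRIT-1 g36 cut of JOIN-T v2
`nodeO-cover/LENS-1g9-JoinT-v2.lean` b7b49705adbb81b3, nodeO STATUS l.4915 (A)(D)); `--supports stmt-QuantumFields-27238 --as helper`; count-neutral.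
[I] = [Balaban1987RG1].  Consumer: the sibling `…K0AxJoinTGeomB` (the rows (G1)(G2) verbatim + the fit `kstep_joinT_at_record_geomAB`).

WHAT THIS FILE IS.  ◆ CRIT-1 g36 (D) listed the ingredients of the LARGE-OR-FAR rows «to type: `idxDist` triangle inequality, `diam ≤ torusTreeLen` in cube units (a general
member-pair bound may need writing), `cubeIdxOf ∘ siteOfInt` coordinate bound; `recordPick` IS a nearest cube so `distD` = true distance».  They are PROVED here, over the
record NAMES of ✓`…K0RecordFormatNames` (`idxDist ∕ cubeIdxOf ∕ recordPick ∕ recordSiteGeom ∕ recordE ∕ recordN ∕ recordRNat ∕ recordK₀`) and the tree's torus geometry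
(✓`TreeLengthTorus`, ✓`B12Decay510Torus`, ✓`B12Decay510Window.dist_le_len`):

* §1 the periodic-absolute-value dictionary: the summand `min (val (a−b)) (val (b−a))` of `idxDist` IS `B12Decay510Torus.pabs (a − b) = |valMinAbs (a − b)|`
  (`pabs_eq_cast_min`, `min_val_sub_eq_pabs`, `idxDist_eq_sum_pabs`); hence ★ `idxDist_triangle`, `idxDist_comm`, `pabs_le_idxDist`.
* §2 ★ THE MEMBER-PAIR BOUND `idxDist_le_torusTreeLen`: two cubes of a torus localization domain `X̄ ⊂ (ℤ∕N)^d` are within `d·d_j(X̄) + d` index steps — per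
  coordinate `|a_i − b_i|_N ≤ d_j(X̄) + 1` (`pabs_sub_le_torusTreeLen_add_one`, the sharp `+1` twin of ✓`B12Decay510Torus.pabs_sub_le_torusTreeLen`: every admissible
  graph on the universal cover meets a lift of each closed unit cube, and two of its points are within its length, ✓`dist_le_len`).
* §3 ★ THE LABEL'S CUBE `mul_pabs_cubeIdxOf_recordE_le`: on the exactly-tiled range (`McGuard`, `recordK₀ ≤ K`, so `N = q·Mc` by ✓`recordN_eq_domCount_mul`), for
  `2|z_i| < N` the `i`-th index of the cube of the label `e K μ z` obeys `Mc·|cubeIdx_i|_q + 1 ≤ |z_i| + Mc` (`mul_pabs_blockIdx_le`: coarsening a residue of `ZMod (q·Mc)` to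
  its `Mc`-block costs at most `Mc − 1`).
* §4 arithmetic of the range: `recordRNat ≤ recordN`, `N_{K+1} = L·N_K` (`recordN_succ`, `recordN_le_succ`); `q_K ≤ q_{K+1}` is hand α's ✓`K0AxJoinTGeomA.domCount_le_domCount_succ`
  and `q_{K+1} = L·q_K` the tree's ✓`PortU8.domCount_succ_vol` (not restated).
* §5 ★★ THE CORE ESTIMATE `mul_le_distD_of_far_cube`: a domain owning a cube `c` with `|c_i|_q ≥ D` satisfies, for every label with `2|z_i| < N`,
  `Mc·D ≤ dist(e K μ z, X) + 4Mc·d_j(X) + 4Mc + |z_i| + Mc − 1` (`recordPick` IS a nearest cube, so `distD = Mc·idxDist(cube(label), pick)`, definitional; triangle through the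
  pick and `c`; §2 with `d = 4`; §3).

HONEST FRAMING.  Elementary torus ∕ integer bookkeeping about the record NAMES (helper lemmas of the NODE O record-format programme — registry bookkeeping for
director-ym, NOT a proof of anything of Bałaban's): nothing of [I] is asserted, ported, discharged or refuted; K0ᴬ stmt-QuantumFields-27238 OPEN; NODE O 0∕1; COUNT 8∕28 ·
K 1∕4 UNMOVED; finite `𝕋⁴_{L^K}` at fixed ε — NOT continuum ∕ OS ∕ Clay; **the Yang–Mills mass gap is NOT proved by any of this.**  No `sorry`, no `def`, no `instance`,
no `notation`; standard axioms.
-/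

noncomputable section

open scoped BigOperators

namespace Summit.QuantumFields.YangMills.Theorems.K0AxJoinTGeomB

open Literature.MathematicalPhysics.QuantumFieldTheory.Balaban1983to89
open Literature.MathematicalPhysics.QuantumFieldTheory.Balaban1983to89.Node00
open Literature.MathematicalPhysics.QuantumFieldTheory.Balaban1983to89.T4Continuum (T4Family)
open Literature.MathematicalPhysics.QuantumFieldTheory.Balaban1983to89.TreeLength (len corner cube mem_cube dist_le_one_of_mem_cube)
open Literature.MathematicalPhysics.QuantumFieldTheory.Balaban1983to89.TreeLengthTorus
  (TPt IsTDom TFaceConnected TLinked TAdj proj torusTreeLen TAdmissible exists_tAdmissible le_torusTreeLen)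
open Literature.MathematicalPhysics.QuantumFieldTheory.Balaban1983to89.B12Decay510Torus (pabs pabs_eq_natAbs pabs_le_abs_of_cast_eq pabs_add_le
  pabs_sub_comm pabs_nonneg valMinAbs_intCast_of_two_mul_abs_lt pabs_intCast_of_two_mul_abs_lt)
open Literature.MathematicalPhysics.QuantumFieldTheory.Balaban1983to89.B12Decay510Window (dist_le_len)
open Summit.QuantumFields.YangMills.Theorems.K0RecordFormatNames

/-! ## §1  The periodic absolute value dictionary: `min (val x) (val (−x)) = |valMinAbs x|`, and `idxDist` as a periodic ℓ¹ length -/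

/-- On `ZMod n`, the periodic absolute value `pabs x = |valMinAbs x|` IS the two-sided torus distance `min (val x) (val (−x))` to `0` (the tree's
✓`BIJ85Prop12TorusBridgeGeom.min_val_neg_val`, read through `pabs`). [folklore] -/
theorem pabs_eq_cast_min {n : ℕ} [NeZero n] (x : ZMod n) : pabs x = ((min x.val (-x).val : ℕ) : ℤ) := by
  rw [pabs_eq_natAbs, ZMod.valMinAbs_natAbs_eq_min, ZMod.neg_val]
  split_ifs with h0
  · subst h0; simp
  · rfl

/-- The summand of `idxDist` is the periodic absolute value `pabs` of the coordinate difference. [folklore] -/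
theorem min_val_sub_eq_pabs {n : ℕ} [NeZero n] (x y : ZMod n) : ((min (x - y).val (y - x).val : ℕ) : ℤ) = pabs (x - y) := by
  rw [show y - x = -(x - y) from (neg_sub x y).symm, pabs_eq_cast_min]

/-- `idxDist` as the sum of the periodic absolute values of the coordinate differences (cast to `ℝ`). [folklore] -/
theorem idxDist_eq_sum_pabs {d n : ℕ} [NeZero n] (a b : TPt d n) : (idxDist a b : ℝ) = ∑ i, (pabs (a i - b i) : ℝ) := by
  unfold idxDist
  rw [Nat.cast_sum]
  refine Finset.sum_congr rfl fun i _ => ?_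
  have h := min_val_sub_eq_pabs (a i) (b i)
  have h' : (((min (a i - b i).val (b i - a i).val : ℕ) : ℤ) : ℝ) = ((pabs (a i - b i) : ℤ) : ℝ) := by rw [h]
  rw [Int.cast_natCast] at h'
  exact h'

/-- `idxDist` is symmetric. [folklore] -/
theorem idxDist_comm {d n : ℕ} [NeZero n] (a b : TPt d n) : idxDist a b = idxDist b a := by
  unfold idxDist
  exact Finset.sum_congr rfl fun i _ => min_comm _ _

/-- **Triangle inequality for `idxDist`.** [folklore] -/
theorem idxDist_triangle {d n : ℕ} [NeZero n] (a b c : TPt d n) : (idxDist a c : ℝ) ≤ idxDist a b + idxDist b c := by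
  rw [idxDist_eq_sum_pabs, idxDist_eq_sum_pabs, idxDist_eq_sum_pabs, ← Finset.sum_add_distrib]
  refine Finset.sum_le_sum fun i _ => ?_
  have h : a i - c i = (a i - b i) + (b i - c i) := by ring
  rw [h]
  exact_mod_cast pabs_add_le (a i - b i) (b i - c i)

/-- One coordinate is bounded by `idxDist`. [folklore] -/
theorem pabs_le_idxDist {d n : ℕ} [NeZero n] (a b : TPt d n) (i : Fin d) : (pabs (a i - b i) : ℝ) ≤ idxDist a b := by
  rw [idxDist_eq_sum_pabs]
  exact Finset.single_le_sum (f := fun j => (pabs (a j - b j) : ℝ)) (fun j _ => by exact_mod_cast pabs_nonneg _)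
    (Finset.mem_univ i)

/-! ## §2  The member-pair bound: two cubes of a torus localization domain are within `d·(d_j + 1)` index steps -/

/-- **Sharp per-coordinate diameter bound**: for two cubes `a, b` of a torus localization domain `X̄` and every coordinate `i`, `|a_i − b_i|_N ≤ d_j(X̄) + 1`
(every admissible graph on the cover meets a lift of each cube; the two meeting points are within its length by `dist_le_len`; the unit cubes add `1`). [folklore] -/
theorem pabs_sub_le_torusTreeLen_add_one {d N : ℕ} [NeZero N] {X : Finset (TPt d N)} (hX : X.Nonempty) (hc : TFaceConnected X)
    {a b : TPt d N} (ha : a ∈ X) (hb : b ∈ X) (i : Fin d) : (pabs (a i - b i) : ℝ) ≤ torusTreeLen X + 1 := by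
  obtain ⟨T₀, hT₀, -⟩ := exists_tAdmissible hX hc
  have h := le_torusTreeLen (a := (pabs (a i - b i) : ℝ) - 1) ⟨T₀, hT₀⟩ fun T hT => by
    obtain ⟨x, hxa, p, hpT, hpx⟩ := hT.meets a ha
    obtain ⟨y, hyb, q, hqT, hqy⟩ := hT.meets b hb
    have h3 : dist p q ≤ len T := dist_le_len hT.connected.isPreconnected hpT hqT
    have h4 : dist (p i) (q i) ≤ dist p q := dist_le_pi_dist p q i
    rw [Real.dist_eq] at h4
    obtain ⟨hx1, hx2⟩ := mem_cube.1 hpx i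
    obtain ⟨hy1, hy2⟩ := mem_cube.1 hqy i
    have h5 : |((x i - y i : ℤ) : ℝ)| ≤ |p i - q i| + 1 := by
      rw [abs_le]
      have := abs_le.1 (le_refl |p i - q i|)
      have ha' := le_abs_self (p i - q i)
      have hb' := neg_abs_le (p i - q i)
      push_cast
      constructor <;> linarith
    have h6 : (pabs (a i - b i) : ℝ) ≤ |((x i - y i : ℤ) : ℝ)| := by
      rw [← Int.cast_abs]
      have hrep : (((x i - y i : ℤ)) : ZMod N) = a i - b i := by
        have hx := congrFun hxa i
        have hy := congrFun hyb i
        simp only [proj] at hx hy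
        push_cast
        rw [hx, hy]
      exact_mod_cast pabs_le_abs_of_cast_eq hrep
    linarith
  linarith

/-- **Member-pair bound**: two cubes of a torus localization domain `X̄ ⊂ (ℤ∕N)^d` are within `d·d_j(X̄) + d` index steps (periodic `ℓ¹`). [folklore] -/
theorem idxDist_le_torusTreeLen {d N : ℕ} [NeZero N] {X : Finset (TPt d N)} (hX : IsTDom X) {a b : TPt d N} (ha : a ∈ X) (hb : b ∈ X) :
    (idxDist a b : ℝ) ≤ d * torusTreeLen X + d := by
  rw [idxDist_eq_sum_pabs]
  calc ∑ i, (pabs (a i - b i) : ℝ) ≤ ∑ _i : Fin d, (torusTreeLen X + 1) :=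
        Finset.sum_le_sum fun i _ => pabs_sub_le_torusTreeLen_add_one hX.1 hX.2 ha hb i
    _ = d * torusTreeLen X + d := by rw [Finset.sum_const, Finset.card_univ, Fintype.card_fin, nsmul_eq_mul]; ring

/-! ## §3  The cube of a window label: `Mc·|cubeIdx_i|_q ≤ |z_i| + Mc − 1` on an exactly-tiled torus (`N = q·Mc`) -/

/-- **Coarsening a residue to its `Mc`-block costs at most `Mc − 1`**: on `ZMod N` with `N = q·Mc`, the block index `⌊val u ∕ Mc⌋ mod q` of a residue `u` satisfies
`Mc·|block|_q + 1 ≤ |u|_N + Mc`. [folklore] -/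
theorem mul_pabs_blockIdx_le {q Mc N : ℕ} [NeZero q] [NeZero N] (hMc : 0 < Mc) (hN : N = q * Mc) (u : ZMod N) :
    (Mc : ℤ) * pabs (((u.val / Mc : ℕ) : ZMod q)) + 1 ≤ pabs u + Mc := by
  set t := u.val with ht
  have htN : t < N := ZMod.val_lt u
  have hsq : t / Mc < q := (Nat.div_lt_iff_lt_mul hMc).2 (hN ▸ htN)
  set s := t / Mc with hs
  set v : ZMod q := ((s : ℕ) : ZMod q) with hv
  have hvval : v.val = s := ZMod.val_cast_of_lt hsq
  rw [pabs_eq_cast_min, pabs_eq_cast_min, ZMod.neg_val, ZMod.neg_val]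
  simp only [hvval, ← ht]
  have hdm : Mc * s + t % Mc = t := Nat.div_add_mod t Mc
  have hr : t % Mc < Mc := Nat.mod_lt t hMc
  have hsq' : Mc * s ≤ Mc * q := Nat.mul_le_mul_left Mc hsq.le
  -- the two one-sided bounds, in ℕ
  have key : Mc * min s (if v = 0 then 0 else q - s) + 1 ≤ min t (if u = 0 then 0 else N - t) + Mc := by
    by_cases hu : u = 0
    · have ht0 : t = 0 := by rw [ht, hu, ZMod.val_zero]
      have hs0 : s = 0 := by rw [hs, ht0, Nat.zero_div]
      have hv0 : v = 0 := by rw [hv, hs0, Nat.cast_zero]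
      simp only [hv0, hu, if_true, hs0, ht0, min_self, mul_zero, zero_add]
      exact hMc
    · rw [if_neg hu]
      by_cases hv0 : v = 0
      · rw [if_pos hv0]
        rw [Nat.min_zero, Nat.mul_zero]
        omega
      · rw [if_neg hv0, ← min_add_add_right]
        refine le_min ?_ ?_
        · have h1 : Mc * min s (q - s) ≤ Mc * s := Nat.mul_le_mul_left Mc (min_le_left _ _)
          omega
        · have h1 : Mc * min s (q - s) ≤ Mc * (q - s) := Nat.mul_le_mul_left Mc (min_le_right _ _)
          rw [Nat.mul_sub] at h1
          subst hN
          have hqMc : q * Mc = Mc * q := Nat.mul_comm q Mc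
          omega
  exact_mod_cast key

variable (F : T4Family)

/-- The site of the window label `e K μ z`, coordinatewise: the residue of `−z_i`. [cite: Balaban1987RG1, (1.20)–(1.21) p.264 (bookkeeping)] -/
theorem recordE_snd_apply (k K : ℕ) (μ : Fin 4) (z : Fin 4 → ℤ) (i : Fin (F.P K).d) :
    (recordE F k K μ z).2 i = ((-z (Fin.cast (F.P_d K) i) : ℤ) : ZMod ((F.P K).sitesPerDir (k + 1))) := rfl

/-- The cube index of a label, coordinatewise. [cite: Balaban1987RG1, p.257 (bookkeeping)] -/
theorem cubeIdxOf_apply (Mc k K : ℕ) (y : Site (F.P K) (k + 1)) (i : Fin (F.P K).d) :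
    cubeIdxOf F Mc k K y i = (((y i).val / Mc : ℕ) : ZMod (Sect2.domCount (F.P K) Mc (k + 1))) := rfl

variable {F}

/-- An admissible catalogue letter is `≥ 1`. [cite: Balaban1987RG1, p.257 (bookkeeping)] -/
theorem one_le_of_mcGuard {Mc : ℕ} (hMc : McGuard F Mc) : 1 ≤ Mc := by
  obtain ⟨c, rfl⟩ := hMc
  exact Nat.one_le_pow _ _ (by have := F.hL.2; omega)

/-- **The cube of an inner-window label is near the base cube**: on the exactly-tiled range, for `2|z_i| < N`, the `i`-th index of the cube of the label `e K μ z` is within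
`(|z_i| + Mc − 1) ∕ Mc` torus steps of `0`: `Mc·|cubeIdx_i|_q + 1 ≤ |z_i| + Mc`. [cite: Balaban1987RG1, p.257, (1.21) p.264] -/
theorem mul_pabs_cubeIdxOf_recordE_le {Mc k K : ℕ} (hMc : McGuard F Mc) (hK : recordK₀ F Mc k ≤ K) (μ : Fin 4) (z : Fin 4 → ℤ) (i : Fin (F.P K).d)
    (hz : 2 * |z (Fin.cast (F.P_d K) i)| < (recordN F k K : ℤ)) :
    (Mc : ℤ) * pabs (cubeIdxOf F Mc k K (recordE F k K μ z).2 i) + 1 ≤ |z (Fin.cast (F.P_d K) i)| + Mc := by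
  have hN : (F.P K).sitesPerDir (k + 1) = Sect2.domCount (F.P K) Mc (k + 1) * Mc := recordN_eq_domCount_mul hMc hK
  have h1 := mul_pabs_blockIdx_le (q := Sect2.domCount (F.P K) Mc (k + 1)) (one_le_of_mcGuard hMc) hN ((recordE F k K μ z).2 i)
  rw [cubeIdxOf_apply]
  have h2 : pabs ((recordE F k K μ z).2 i) = |z (Fin.cast (F.P_d K) i)| := by
    rw [recordE_snd_apply, pabs_intCast_of_two_mul_abs_lt (by rw [abs_neg]; exact hz), abs_neg]
  rw [h2] at h1
  exact h1

/-! ## §4  Arithmetic of the exactly-tiled range: `recordRNat ≤ recordN`, `N_{K+1} = L·N_K` -/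

/-- `recordRNat ≤ recordN` on the exactly-tiled range (`Mc⌊q∕2⌋ ≤ q·Mc`). [cite: Balaban1987RG1, (1.21) p.264 (bookkeeping)] -/
theorem recordRNat_le_recordN {Mc k K : ℕ} (hMc : McGuard F Mc) (hK : recordK₀ F Mc k ≤ K) : recordRNat F Mc k K ≤ recordN F k K := by
  rw [recordN_eq_domCount_mul hMc hK, Nat.mul_comm]
  exact (recordRNat_le F Mc k K).trans le_rfl

/-- The closed form `recordN F k K = 2·L^{m+K−(k+1)}`. [cite: Balaban1987RG1, (0.1) p.251 (bookkeeping)] -/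
theorem recordN_eq_two_mul_pow (k K : ℕ) : recordN F k K = 2 * F.L ^ (F.m + K - (k + 1)) := by
  simp [recordN, Params.sitesPerDir, T4Family.P, Missing.params4]

/-- **One volume step multiplies the unit torus by `L`**: `N_{K+1} = L·N_K` (standing range `k + 1 ≤ m + K`). [cite: Balaban1987RG1, (0.1) p.251, (1.21) p.264] -/
theorem recordN_succ {k K : ℕ} (hk : k + 1 ≤ F.m + K) : recordN F k (K + 1) = F.L * recordN F k K := by
  rw [recordN_eq_two_mul_pow, recordN_eq_two_mul_pow, show F.m + (K + 1) - (k + 1) = F.m + K - (k + 1) + 1 by omega, pow_succ]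
  ring

/-- `N_K ≤ N_{K+1}`. [cite: Balaban1987RG1, (0.1) p.251 (bookkeeping)] -/
theorem recordN_le_succ {k K : ℕ} (hk : k + 1 ≤ F.m + K) : recordN F k K ≤ recordN F k (K + 1) := by
  rw [recordN_succ hk]
  exact Nat.le_mul_of_pos_left _ (by have := F.hL.2; omega)

/-- From `recordK₀` on, the level `k + 1` is in the standing range. [cite: Balaban1987RG1, p.257 (bookkeeping)] -/
theorem succ_le_of_recordK₀_le {Mc k K : ℕ} (hK : recordK₀ F Mc k ≤ K) : k + 1 ≤ F.m + K := by
  unfold recordK₀ at hK; omega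

/-! ## §5  THE CORE ESTIMATE: a domain owning a cube FAR from the base cube is large-or-far from every inner-window label -/

/-- `dist(l, X) = Mc · idxDist(cube(l), pick)` (definitional). [cite: Balaban1987RG1, §0 p.257 (bookkeeping)] -/
theorem recordSiteGeom_distD_eq (Mc k K : ℕ) (l : RespLabel F k K) (X : (recordDomSys F Mc k K).Dom) :
    (recordSiteGeom F Mc k K).distD l X = (Mc : ℝ) * (idxDist (cubeIdxOf F Mc k K l.2) (recordPick F Mc k K l X) : ℝ) := rfl

/-- `d_j` of the record's catalogue is `torusTreeLen` (definitional). [cite: Balaban1987RG1, p.257 (bookkeeping)] -/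
theorem recordDomSys_dj_eq (Mc k K : ℕ) (X : (recordDomSys F Mc k K).Dom) : (recordDomSys F Mc k K).dj X = torusTreeLen X.1 := rfl

/-- **CORE.** On the exactly-tiled range: if a domain `X ∈ 𝐃_{k+1}(T_K)` owns a cube `c` whose `i`-th index is at torus distance `≥ D` from `0`, then for every label
`e K μ z` with `2|z_i| < N`:  `Mc·D ≤ dist(e K μ z, X) + 4Mc·d_j(X) + 4Mc + |z_i| + Mc − 1` (nearest cube ⇒ `distD` is a true distance; triangle inequality for the
periodic `ℓ¹` index distance through the nearest cube and `c`; member-pair bound `idxDist ≤ 4·d_j + 4`; the label's cube is within `(|z_i| + Mc − 1)∕Mc` of `0`).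
[cite: Balaban1987RG1, §0 p.257, (1.21) p.264] -/
theorem mul_le_distD_of_far_cube {Mc k K : ℕ} (hMc : McGuard F Mc) (hK : recordK₀ F Mc k ≤ K) (X : (recordDomSys F Mc k K).Dom)
    {c : TPt (F.P K).d (Sect2.domCount (F.P K) Mc (k + 1))} (hc : c ∈ (X.1 : Finset _)) (i : Fin (F.P K).d) {D : ℕ} (hD : (D : ℤ) ≤ pabs (c i))
    (μ : Fin 4) (z : Fin 4 → ℤ) (hz : 2 * |z (Fin.cast (F.P_d K) i)| < (recordN F k K : ℤ)) :
    (Mc : ℝ) * D ≤ (recordSiteGeom F Mc k K).distD (recordE F k K μ z) X + 4 * Mc * (recordDomSys F Mc k K).dj X + 4 * Mc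
      + |(z (Fin.cast (F.P_d K) i) : ℝ)| + Mc - 1 := by
  classical
  set l := recordE F k K μ z with hl
  set a := cubeIdxOf F Mc k K l.2 with ha
  set p := recordPick F Mc k K l X with hp
  have hpX : p ∈ (X.1 : Finset _) := (recordPick_spec F Mc k K l X).1
  rw [recordSiteGeom_distD_eq, recordDomSys_dj_eq]
  have hMc0 : (0 : ℝ) ≤ Mc := Nat.cast_nonneg _
  have h1 : (pabs (c i) : ℝ) ≤ pabs (a i - c i) + pabs (a i) := by
    have h := pabs_add_le (c i - a i) (a i)
    rw [sub_add_cancel, pabs_sub_comm] at h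
    exact_mod_cast h
  have h2 : (pabs (a i - c i) : ℝ) ≤ idxDist a c := pabs_le_idxDist a c i
  have h3 : (idxDist a c : ℝ) ≤ idxDist a p + idxDist p c := idxDist_triangle a p c
  have h4 : (idxDist p c : ℝ) ≤ 4 * torusTreeLen X.1 + 4 := by
    have h := idxDist_le_torusTreeLen X.2 hpX hc
    have hd : ((F.P K).d : ℝ) = 4 := by rw [T4Family.P_d]; norm_num
    rw [hd] at h
    exact h
  have h5 : (Mc : ℝ) * pabs (a i) + 1 ≤ |(z (Fin.cast (F.P_d K) i) : ℝ)| + Mc := by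
    have h := mul_pabs_cubeIdxOf_recordE_le hMc hK μ z i hz
    have h' : ((Mc : ℤ) : ℝ) * ((pabs (cubeIdxOf F Mc k K (recordE F k K μ z).2 i) : ℤ) : ℝ) + 1 ≤ ((|z (Fin.cast (F.P_d K) i)| : ℤ) : ℝ) + Mc := by
      exact_mod_cast h
    rw [Int.cast_abs] at h'
    simpa [ha, hl] using h'
  have hD' : (D : ℝ) ≤ pabs (c i) := by exact_mod_cast hD
  have e1 : (Mc : ℝ) * D ≤ Mc * pabs (c i) := mul_le_mul_of_nonneg_left hD' hMc0
  have e2 : (Mc : ℝ) * pabs (c i) ≤ Mc * (idxDist a p + (4 * torusTreeLen X.1 + 4)) + Mc * pabs (a i) := by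
    have : (pabs (c i) : ℝ) ≤ idxDist a p + (4 * torusTreeLen X.1 + 4) + pabs (a i) := by linarith
    nlinarith
  nlinarith

end Summit.QuantumFields.YangMills.Theorems.K0AxJoinTGeomB

end
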